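import Literature.MathematicalPhysics.QuantumFieldTheory.Balaban1983to89.B8SockH59NotAtCube
import Literature.MathematicalPhysics.QuantumFieldTheory.Balaban1983to89.B8LeafModelZd3NonVacuity

/-!
# `Balaban1983to89.B8SockH59NotAtUnivDegenerate` — KERNEL CERTIFICATE: the (1.59)-socket `B8LeafModelZd.SockH59` of the N05 knit is FALSE at
# members of `ZdIdx d L` with `Ω₀ = ℤᵈ` whose LOWER-TRUNCATION constraint data are EMPTY — so the hypothesis «`SockH59` at every univ member»
# (`∀ i : {i : ZdIdx d L // i.Ω 0 = univ}, SockH59 … i.1.Λs i.1.Λb`) is unsatisfiable, for every `B₀ > 0`, `B₀′ ≥ 0`, `cP > 0`, `d ≥ 2`, `L ≥ 1`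

statement-level skeleton of published theorems with citation tags; proofs where landed; nothing here is a claim about the
Yang–Mills mass gap

`[Balaban1985RegularSpaces]` ("B8", CMP **99** (1985) 75–102) (1.59) p. 86, Thm 4 p. 88, (1.29) p. 81, (1.33)–(1.38) p. 82, (1.66) p. 87, p. 77
(«Ω_j = T_η»; the truncated sequences `{Ω₀, …, Ω_m}` and their constraint sets 𝔅_m); [4] = `[Balaban1985BackgroundPropagators]` Thm 3.3 p. 399.
PDF held: `paper:balaban1985-cmp99-regular-spaces-gauge-fixing`.

CITATION HEADER (lean-in-tree rule).  Cell `pub-ymgap` (YM Track A, HUMAN RULING D-0062), DAG node N16 = NE3 (consumer of node N05 = [B8]), seat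
`pub-ymgap-dag-n16-c` (g6; director-ym R134 (a), strategy s1).  Third located typing defect of the N05 socket family, after n05-e's
`B8Ineq159FlatCornerDefect` ∕ `B8SockH59CornerDefect` ∕ `B8SockH59NotAtCube` (the socket is false at FINITE-`Ω₀` cube members — exposed corner)
and `B8JunctionH59Vacuity`.  Those certificates leave the univ members (`Ω 0 = ℤᵈ`) untouched, and the repair shape adopted downstream was
«key the sockets at the univ members only» (`B8LeafKnitZd3E.thm4Printed_zd3_mapE` at `ι := Subtype.val`;
`Summit.….N16OfSocketsZd3.n16_of_socketsZd3E`).  HERE: that repair is INSUFFICIENT.  The index `B8LeafModelZd.ZdIdx` carries, besides the top data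
`Λs k`∕`Λb k` (laws `htower`, `hpart`), the constraint data `Λs m`∕`Λb m` of EVERY truncation `m ≤ k`, constrained only by the upper-bound laws
`hbox`∕`hclass`; so for `k ≥ 2` a member with `Ω_j = ℤᵈ` for all `j`, proper top data (`Λs k j = {j = k}`, `Λb k j = {j = k}` — print's
«Ω_j = T_η») and EMPTY data at the truncation `m = 1` is admissible (§3).  At such a member the body of `SockH59` at `m = 1` has (1.29)
`Restr129 L 1 (Λs 1)` VACUOUS and its block-average term `wsup` over an EMPTY index, and it is refuted (§1) by the constant abelian witness:
datum `(U₀, U′) = (1, 1)` (admissible in every class, as in `B8SockH59NotAtCube`), gauge `u(x) = g₀^{x_τ}` (`g₀ = e^{iηa}`, `a = t·1`,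
`t = c⋆(Lᵐη)⁻¹∕2`), whose pure gauge `W = u⁻¹·u(· + e_κ)` is the CONSTANT field `g₀^{(e_κ)_τ}` (`g₀` on the τ-bonds, `1` on the others),
exponent `A′ = a` on the τ-bonds, `0` else: `mgauge 1 u W = 1`; the Landau condition (1.38) `IsLandau138W L m η ℤᵈ Λs 1 W` holds with
multiplier `0` for ANY `Λs` because the flat covariant divergence of the constant field `(iη)⁻¹ log W` vanishes; `W = e^{iηA′}`,
`‖A′‖ = t ≤ c⋆(Lʲη)⁻¹` (`j ≤ m`); «`A′ = 0` off the collars» is vacuous at `Ω₀ = ℤᵈ` (every bond is a plaquette side, `d ≥ 2`); and the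
current `J(A′) = D^{η*}_1(D^η_1 A′) = 0` (flat covariant curl of a constant), so the right side is `B₀·(0 + 0) = 0` while the left side is
`≥ (L⁰η)·‖A′(0, τ)‖ = η·t > 0`.  ★ `h59_body_false_of_emptyTruncation` (generic data), ★ `not_sockH59_of_emptyTruncation` (the named socket),
`exists_member_univ_emptyTruncation` (§3), ★★ `not_forall_univ_sockH59`, `not_forall_sockH59` (§4).

CONSEQUENCE (recorded, count-neutral).  Every theorem whose hypothesis is `SockH59` AT EVERY UNIV MEMBER is vacuous as stated; the sound
sub-index for a consumer must ALSO pin the truncation data — e.g. the all-torus PROPER members (`Ω ≡ ℤᵈ`, `Λs m j = {j = m}`,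
`Λb m j = {j = m}`; the member of `B8LeafModelZd3NonVacuity.exists_member_univ`), where neither this witness nor the corner witness applies;
or an index law tying `Λs m`∕`Λb m` to the canonical truncation of the top data (the socket owner's call).  PRINT IS CONSISTENT: the
truncated problems of Theorem 4's induction (p. 88) carry the canonical constraint sets of `{Ω₀, …, Ω_m}` (p. 77, (1.5)), never empty ones.

HONEST SCOPE.  A negative typing certificate with an explicit witness; nothing of [4] ∕ [Balaban1985RegularSpaces] is proved or refuted;
count-neutral; N05 ∕ N16 NOT discharged; SECOND-GAP: none; one finite `T⁴` programme at fixed `ε`, Bałaban as printed; nothing continuum ∕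
ℝ⁴ ∕ OS ∕ mass-gap ∕ Clay.  No `sorry`, no `def`, no `instance`, no `notation`.  Unit `pub-ymgap-dag-n16-c` (g6), 2026-08-27.
-/

noncomputable section

namespace Literature.MathematicalPhysics.QuantumFieldTheory.Balaban1983to89.B8SockH59NotAtUnivDegenerate

open NormedSpace
open Complex (I)
open B7Prop1Explicit (e e_apply expUnit val_expUnit)
open B7Prop2Explicit (unitaryUnits avgIter)
open B7Eq92Concrete (mgauge mgauge_apply)
open B8Lemma1NonAbelian (mulCfg)
open B8Ineq132 (covDeriv covDerivFwd BondTouches InAk)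
open B8Eq119TwistedAxial (InAx Restr129 inAx_self)
open B8Eq184Proof (cfgExp)
open B7Prop1Local (InBox loK bondHiK)
open B8Eq143PlaqExpansion (pdiv)
open B8Eq146AExpansion (plaqCovDeriv plaqCovDeriv_eq_covDerivFwd iEta)
open B8Eq155JBound (Jcur wsup wsup_le wsup_nonneg)
open B8ScaledSupNorm (weight msup Bdd bondNorm msup_le msup_nonneg weight_mul_norm_le_msup weight_neg_natCast)
open B8Eq138LandauZd (covDivB covLap QT IsLandau138 IsLandau138W logCfg)
open B8Eq140Level (SideTouches sideTouches_of_bondTouches)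
open B7Prop4GeneralLevels (linCovIter)
open B8Eq191FlatStencils (covDerivFwd_flat_apply covDeriv_flat_apply covLap_flat_apply QT_flat_apply)
open B8Ineq130 (tlo thi)
open B8Eq131Cubes (flm under_flm)
open B8Eq106Local (under_iff_tower)
open B8LeafModelZd (ZdIdx SockH59)
open B8Prop6OfThm4 (one_inAk)
open B8Thm4Concrete (mulCfg_eq_mul)

export B7Prop1Explicit (Site)

variable {d : ℕ}

/-! ## §1 ★ The body of `SockH59` at `(U₀, U′) = (1, 1)`, `Ω₀ = ℤᵈ`, is false whenever the truncation's constraint data are empty -/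

section Body

variable {𝔸 : Type*} [CStarAlgebra 𝔸] [Nontrivial 𝔸]

/-- ★ **THE `𝔸`-VALUED (1.59) CLAUSE OF THE N05 SOCKET FAMILY AT BACKGROUND `1`, `Ω₀ = ℤᵈ`, IS FALSE AT EMPTY TRUNCATION DATA** — the body of
`B8LeafModelZd.SockH59` at `U₀ = 1`, `U′ = 1`, truncation `m` (binders `u, W, A′`: `u` unitary, `mgauge 1 u W = 1`, `Restr129 L m Λs 1 u`,
`IsLandau138W L m η (Ω 0) Λs 1 W`, `A′` self-adjoint, `W = e^{iηA′}` ∧ `‖A′‖ ≤ c⋆(Lʲη)⁻¹` on the collars, `A′ = 0` off them ⇒ the two members), for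
every `c⋆ > 0`, every `B₀`, `d ≥ 2`, `L ≥ 1`, `η > 0`, at domain data with `Ω 0 = ℤᵈ` and `Λs j = ∅`, `Λb j = ∅` for `j ≤ m`.  Witness: the
linear-phase gauge `u(x) = g₀^{x_τ}`, its CONSTANT pure gauge `W`, the constant exponent `A′ = a·δ_τ` (module docstring): the right side is `0`,
the left side `≥ η·t > 0`. [cite: Balaban1985RegularSpaces, (1.59) p.86, Thm 4 p.88 ((1.68)–(1.69)), (1.29) p.81, (1.38) p.82, p.77; Balaban1985BackgroundPropagators, Thm 3.3 p.399] -/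
theorem h59_body_false_of_emptyTruncation (hd2 : 2 ≤ d) {L : ℕ} (hL : 1 ≤ L) {η : ℝ} (hη : 0 < η) (m : ℕ)
    (Ω : ℕ → Set (Site d)) (hΩ0 : Ω 0 = Set.univ) (Λs : ℕ → Set (Site d)) (Λb : ℕ → Set (Site d × Fin d))
    (hΛs : ∀ j, j ≤ m → Λs j = ∅) (hΛb : ∀ j, j ≤ m → Λb j = ∅) (B₀ : ℝ) {cst : ℝ} (hcst : 0 < cst) :
    ¬ (∀ (u : Site d → 𝔸ˣ) (W : Site d → Fin d → 𝔸ˣ) (A' : Site d → Fin d → 𝔸),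
      (∀ x, u x ∈ unitaryUnits 𝔸) → mgauge (1 : Site d → Fin d → 𝔸ˣ) u W = 1 → Restr129 L m Λs (1 : Site d → Fin d → 𝔸ˣ) u →
      IsLandau138W L m η (Ω 0) Λs (1 : Site d → Fin d → 𝔸ˣ) W →
      (∀ y τ, IsSelfAdjoint (A' y τ)) →
      (∀ j, j ≤ m → ∀ (y : Site d) (τ : Fin d), SideTouches (Ω j) y τ →
        W y τ = cfgExp η A' y τ ∧ ‖A' y τ‖ ≤ cst * ((L : ℝ) ^ j * η)⁻¹) →
      (∀ (y : Site d) (τ : Fin d), (∀ j, j ≤ m → ¬ SideTouches (Ω j) y τ) → A' y τ = 0) →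
      msup L m η (-(1 : ℝ)) (fun j (b : Site d × Fin d) => SideTouches (Ω j) b.1 b.2) (fun b => A' b.1 b.2)
          ≤ B₀ * (bondNorm L m η (-(3 : ℝ)) Ω (fun x μ => Jcur η (1 : Site d → Fin d → 𝔸ˣ) A' μ x)
            + wsup 1 (fun p : {p : ℕ × (Site d × Fin d) // p.1 ≤ m ∧ p.2 ∈ Λb p.1} =>
                linCovIter L (1 : Site d → Fin d → 𝔸ˣ) (iEta η A') p.1.1 p.1.2.1 p.1.2.2)) ∧
        msup L m η (-(2 : ℝ)) (fun j (t : Fin d × Fin d × Site d) => SideTouches (Ω j) t.2.2 t.2.1)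
            (fun t => covDerivFwd η (1 : Site d → Fin d → 𝔸ˣ) t.1 (fun z => A' z t.2.1) t.2.2)
          ≤ B₀ * (bondNorm L m η (-(3 : ℝ)) Ω (fun x μ => Jcur η (1 : Site d → Fin d → 𝔸ˣ) A' μ x)
            + wsup 1 (fun p : {p : ℕ × (Site d × Fin d) // p.1 ≤ m ∧ p.2 ∈ Λb p.1} =>
                linCovIter L (1 : Site d → Fin d → 𝔸ˣ) (iEta η A') p.1.1 p.1.2.1 p.1.2.2))) := by
  intro H
  have hL1 : (1 : ℝ) ≤ L := by exact_mod_cast hL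
  -- a lattice direction `τ₀` (and a second one, for the plaquette-side bookkeeping: `d ≥ 2`)
  haveI : Nontrivial (Fin d) := Fin.nontrivial_iff_two_le.mpr hd2
  obtain ⟨τ₀⟩ : Nonempty (Fin d) := ⟨⟨0, by omega⟩⟩
  have hside : ∀ (y : Site d) (τ : Fin d), SideTouches (Ω 0) y τ := by
    intro y τ
    rw [hΩ0]
    obtain ⟨κ, hκ⟩ := exists_ne τ
    exact sideTouches_of_bondTouches hκ (Or.inl (Set.mem_univ y))
  -- THE WITNESS: `a = t·1`, `g₀ = e^{iηa}`, `u(x) = g₀^{x_τ₀}`, `W = u⁻¹u(·+e)`, `A′ = a` on the `τ₀`-bonds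
  obtain ⟨t, ht⟩ : ∃ t : ℝ, t = cst * ((L : ℝ) ^ m * η)⁻¹ / 2 := ⟨_, rfl⟩
  have ht0 : 0 < t := by rw [ht]; positivity
  obtain ⟨a, ha⟩ : ∃ a : 𝔸, a = ((t : ℝ) : ℂ) • (1 : 𝔸) := ⟨_, rfl⟩
  have ha_sa : IsSelfAdjoint a := by rw [ha]; exact B8Eq155JBound.isSelfAdjoint_real_smul t (IsSelfAdjoint.one 𝔸)
  have ha_norm : ‖a‖ = t := by rw [ha, norm_smul, Complex.norm_real, Real.norm_of_nonneg ht0.le, norm_one, mul_one]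
  obtain ⟨g₀, hg₀⟩ : ∃ g₀ : 𝔸ˣ, g₀ = expUnit ((I : ℂ) • (η • a)) := ⟨_, rfl⟩
  have hg₀u : g₀ ∈ unitaryUnits 𝔸 := by
    rw [B7Prop2Explicit.mem_unitaryUnits, hg₀, val_expUnit]
    exact B8Ineq170.exp_I_smul_mem_unitary (B8Prop5Reality.isSelfAdjoint_real_smul η ha_sa)
  obtain ⟨u, hu⟩ : ∃ u : Site d → 𝔸ˣ, u = fun x => g₀ ^ (x τ₀) := ⟨_, rfl⟩
  obtain ⟨W, hW⟩ : ∃ W : Site d → Fin d → 𝔸ˣ, W = fun x κ => (u x)⁻¹ * u (x + e κ) := ⟨_, rfl⟩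
  -- the pure gauge is the CONSTANT field `g₀^{(e κ) τ₀}`
  have hWval : ∀ (x : Site d) (κ : Fin d), W x κ = g₀ ^ (e κ τ₀) := by
    intro x κ
    rw [hW, hu]
    simp only [Pi.add_apply]
    rw [← zpow_neg, ← zpow_add, neg_add_cancel_left]
  have hWτ : ∀ x : Site d, W x τ₀ = g₀ := fun x => by rw [hWval, e_apply, if_pos rfl, zpow_one]
  have hW1 : ∀ (x : Site d) (κ : Fin d), κ ≠ τ₀ → W x κ = 1 := fun x κ hκ => by
    rw [hWval, e_apply, if_neg (Ne.symm hκ), zpow_zero]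
  obtain ⟨A', hA'⟩ : ∃ A' : Site d → Fin d → 𝔸, A' = fun _ κ => if κ = τ₀ then a else 0 := ⟨_, rfl⟩
  have hA'τ : ∀ y : Site d, A' y τ₀ = a := fun y => by rw [hA']; exact if_pos rfl
  have hA'1 : ∀ (y : Site d) (κ : Fin d), κ ≠ τ₀ → A' y κ = 0 := fun y κ hκ => by rw [hA']; exact if_neg hκ
  have hA'bd : ∀ (y : Site d) (κ : Fin d), ‖A' y κ‖ ≤ t := by
    intro y κ
    by_cases hκ : κ = τ₀
    · rw [hκ, hA'τ, ha_norm]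
    · rw [hA'1 y κ hκ, norm_zero]; exact ht0.le
  -- (1) `u` unitary
  have h1 : ∀ x, u x ∈ unitaryUnits 𝔸 := fun x => by rw [hu]; exact (unitaryUnits 𝔸).zpow_mem hg₀u _
  -- (2) `mgauge 1 u W = 1`
  have h2 : mgauge (1 : Site d → Fin d → 𝔸ˣ) u W = 1 := by
    funext x κ
    rw [mgauge_apply, hW]
    simp only [Pi.one_apply, B7Eq92Concrete.Rc_one_apply]
    group
  -- (3) (1.29) is VACUOUS: the truncation's constraint sites are empty
  have h3 : Restr129 L m Λs (1 : Site d → Fin d → 𝔸ˣ) u := by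
    intro j hj y hy
    rw [hΛs j hj] at hy
    exact absurd hy (Set.notMem_empty y)
  -- (4) `W` is in the Landau gauge (1.38) of `1` with multiplier `0`: the flat divergence of the constant field `(iη)⁻¹ log W` vanishes
  have h4 : IsLandau138W L m η (Ω 0) Λs (1 : Site d → Fin d → 𝔸ˣ) W := by
    have hdiv : ∀ x : Site d, covDivB η (1 : Site d → Fin d → 𝔸ˣ) (logCfg η W) x = 0 := by
      intro x
      unfold covDivB
      refine Finset.sum_eq_zero fun μ _ => ?_
      rw [covDeriv_flat_apply]
      simp only [logCfg, hWval, sub_self, smul_zero]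
    refine ⟨fun _ _ => 0, fun x _ => ?_⟩
    have hind : (Ω 0).indicator (covDivB η (1 : Site d → Fin d → 𝔸ˣ) (logCfg η W)) = fun _ => 0 := by
      funext y
      by_cases hy : y ∈ Ω 0
      · rw [Set.indicator_of_mem hy]; exact hdiv y
      · exact Set.indicator_of_notMem hy _
    rw [hind, covLap_flat_apply, QT_flat_apply]
    simp
  -- (5) `A′` self-adjoint
  have h5 : ∀ (y : Site d) (τ : Fin d), IsSelfAdjoint (A' y τ) := by
    intro y τ
    by_cases hτ : τ = τ₀
    · rw [hτ, hA'τ]; exact ha_sa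
    · rw [hA'1 y τ hτ]; exact IsSelfAdjoint.zero 𝔸
  -- (6) `W = e^{iηA′}` and the exponent bound on the collars
  have hinvle : ∀ j, j ≤ m → t ≤ cst * ((L : ℝ) ^ j * η)⁻¹ := by
    intro j hj
    have h0 : 0 < (L : ℝ) ^ j * η := by positivity
    have hle : ((L : ℝ) ^ m * η)⁻¹ ≤ ((L : ℝ) ^ j * η)⁻¹ :=
      inv_anti₀ h0 (mul_le_mul_of_nonneg_right (pow_le_pow_right₀ hL1 hj) hη.le)
    have h3 : 0 ≤ cst * ((L : ℝ) ^ j * η)⁻¹ := by positivity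
    rw [ht]
    nlinarith [mul_le_mul_of_nonneg_left hle hcst.le]
  have h6 : ∀ j, j ≤ m → ∀ (y : Site d) (τ : Fin d), SideTouches (Ω j) y τ →
      W y τ = cfgExp η A' y τ ∧ ‖A' y τ‖ ≤ cst * ((L : ℝ) ^ j * η)⁻¹ := by
    intro j hj y τ _
    refine ⟨?_, (hA'bd y τ).trans (hinvle j hj)⟩
    by_cases hτ : τ = τ₀
    · rw [hτ, hWτ, hg₀]
      exact Units.ext (by rw [val_expUnit, cfgExp, val_expUnit, hA'τ])
    · rw [hW1 y τ hτ]
      exact Units.ext (by rw [cfgExp, val_expUnit, hA'1 y τ hτ, smul_zero, smul_zero, NormedSpace.exp_zero, Units.val_one])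
  -- (7) «`A′` vanishes off the collars» is vacuous: every bond is a side of a plaquette touching `Ω 0 = ℤᵈ`
  have h7 : ∀ (y : Site d) (τ : Fin d), (∀ j, j ≤ m → ¬ SideTouches (Ω j) y τ) → A' y τ = 0 :=
    fun y τ h => absurd (hside y τ) (h 0 (Nat.zero_le _))
  obtain ⟨hmem, -⟩ := H u W A' h1 h2 h3 h4 h5 h6 h7
  -- (8) the right side vanishes: `J(A′) = 0` (flat covariant curl of a constant field), and the block-average index is EMPTY
  have hplaq : plaqCovDeriv η (1 : Site d → Fin d → 𝔸ˣ) A' = fun _ _ _ => 0 := by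
    funext μ ν x
    rw [plaqCovDeriv_eq_covDerivFwd, covDerivFwd_flat_apply, covDerivFwd_flat_apply, hA']
    simp
  have hJ0 : ∀ (μ : Fin d) (x : Site d), Jcur η (1 : Site d → Fin d → 𝔸ˣ) A' μ x = 0 := by
    intro μ x
    unfold Jcur pdiv
    simp [hplaq, covDeriv_flat_apply]
  have hJ : bondNorm L m η (-(3 : ℝ)) Ω (fun x μ => Jcur η (1 : Site d → Fin d → 𝔸ˣ) A' μ x) = 0 := by
    refine le_antisymm (msup_le le_rfl fun j hj b hb => ?_) (msup_nonneg L m hη.le _ _ _)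
    simp only [hJ0, norm_zero, mul_zero, le_refl]
  have hQ : wsup 1 (fun p : {p : ℕ × (Site d × Fin d) // p.1 ≤ m ∧ p.2 ∈ Λb p.1} =>
      linCovIter L (1 : Site d → Fin d → 𝔸ˣ) (iEta η A') p.1.1 p.1.2.1 p.1.2.2) = 0 := by
    refine le_antisymm (wsup_le (fun p => ?_) le_rfl) (wsup_nonneg zero_le_one _)
    have hp := p.2.2
    rw [hΛb p.1.1 p.2.1] at hp
    exact absurd hp (Set.notMem_empty _)
  rw [hJ, hQ, add_zero, mul_zero] at hmem
  -- (9) the left side is at least `η·t > 0`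
  have hBdd : Bdd L m η (-(1 : ℝ)) (fun j (b : Site d × Fin d) => SideTouches (Ω j) b.1 b.2) (fun b => A' b.1 b.2) := by
    refine ⟨(L : ℝ) ^ m * η * t, fun j hj b _ => ?_⟩
    have hw : weight L η (-(1 : ℝ)) j = (L : ℝ) ^ j * η := by simpa using weight_neg_natCast L η 1 j
    rw [hw]
    exact mul_le_mul (mul_le_mul_of_nonneg_right (pow_le_pow_right₀ hL1 hj) hη.le) (hA'bd b.1 b.2) (norm_nonneg _)
      (by positivity)
  have hw0 : weight L η (-(1 : ℝ)) 0 = η := by simpa using weight_neg_natCast L η 1 0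
  have hlow : η * t ≤ msup L m η (-(1 : ℝ)) (fun j (b : Site d × Fin d) => SideTouches (Ω j) b.1 b.2) (fun b => A' b.1 b.2) := by
    have h := weight_mul_norm_le_msup hBdd (Nat.zero_le m) (i := ((0 : Site d), τ₀)) (hside 0 τ₀)
    rw [hw0] at h
    calc η * t = η * ‖A' 0 τ₀‖ := by rw [hA'τ, ha_norm]
      _ ≤ _ := h
  have : 0 < η * t := mul_pos hη ht0
  linarith

end Body

/-! ## §2 ★ The named socket is false at `Ω₀ = ℤᵈ` whenever some truncation `1 ≤ m ≤ k` has empty constraint data -/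

section Sock

variable {𝔸 : Type*} [CStarAlgebra 𝔸] [Nontrivial 𝔸]

/-- ★ **THE NAMED (1.59) SOCKET `B8LeafModelZd.SockH59 L B₀ B₀′ cP η k Ω Λs Λb` IS FALSE AT `Ω 0 = ℤᵈ` WHENEVER SOME TRUNCATION `1 ≤ m ≤ k` HAS
EMPTY CONSTRAINT DATA** (`Λs m j = ∅ = Λb m j` for `j ≤ m`; every `B₀ > 0`, `B₀′ ≥ 0`, `cP > 0`, `d ≥ 2`, `L ≥ 1`, `η > 0`; the other `Ω_j` and
the other truncations are arbitrary).  PROOF: instantiate the socket at `α₀ = α₁ = cP/2`, `U₀ = U′ = 1` (admissible in every class: (1.33)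
`one_inAk`, (1.34)-axial `inAx_self`, (1.35)∕(1.66) with zero differences — as in `B8SockH59NotAtCube.not_sockH59_cubeMember`) and refute its body
at the truncation `m` by `h59_body_false_of_emptyTruncation` (exponent constant `2L·c⋆ + 64B₀′c⋆`, `c⋆ = 5dLB₀cP > 0`).
[cite: Balaban1985RegularSpaces, (1.59) p.86, Thm 4 p.88, (1.33)–(1.35) p.82, (1.66) p.87, (1.29) p.81, p.77; Balaban1985BackgroundPropagators, Thm 3.3 p.399] -/
theorem not_sockH59_of_emptyTruncation (hd2 : 2 ≤ d) {L : ℕ} (hL : 1 ≤ L) {η : ℝ} (hη : 0 < η) {k m : ℕ} (hm : 1 ≤ m)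
    (hmk : m ≤ k) (Ω : ℕ → Set (Site d)) (hΩ0 : Ω 0 = Set.univ) (Λs : ℕ → ℕ → Set (Site d))
    (Λb : ℕ → ℕ → Set (Site d × Fin d)) (hΛs : ∀ j, j ≤ m → Λs m j = ∅) (hΛb : ∀ j, j ≤ m → Λb m j = ∅)
    {B₀ B₀' cP : ℝ} (hB₀ : 0 < B₀) (hB₀' : 0 ≤ B₀') (hcP : 0 < cP) :
    ¬ SockH59 (𝔸 := 𝔸) L B₀ B₀' cP η k Ω Λs Λb := by
  intro H
  have hα : 0 < cP / 2 := by positivity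
  have h1u : ∀ (x : Site d) (κ : Fin d), (1 : Site d → Fin d → 𝔸ˣ) x κ ∈ unitaryUnits 𝔸 := fun _ _ => (unitaryUnits 𝔸).one_mem
  have hmul : mulCfg (1 : Site d → Fin d → 𝔸ˣ) (1 : Site d → Fin d → 𝔸ˣ) = 1 := by rw [mulCfg_eq_mul, mul_one]
  have hA : InAk L k η (cP / 2) Ω (1 : Site d → Fin d → 𝔸ˣ) := one_inAk hL k hη hα _
  have hA' : InAk L k η (cP / 2) Ω (mulCfg (1 : Site d → Fin d → 𝔸ˣ) 1) := by rw [hmul]; exact hA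
  have hAx : ∀ m', m' ≤ k → InAx L m' (Λs m') (1 : Site d → Fin d → 𝔸ˣ) (mulCfg (1 : Site d → Fin d → 𝔸ˣ) 1) :=
    fun m' _ => by rw [hmul]; exact inAx_self L m' _ _
  have h135 : ∀ j, j ≤ k → ∀ (z : Site d) (μ : Fin d), (∀ x, InBox (loK L j z) (bondHiK L j z μ) x → x ∈ Ω j) →
      ‖(avgIter L (mulCfg (1 : Site d → Fin d → 𝔸ˣ) 1) j z μ : 𝔸) - (avgIter L (1 : Site d → Fin d → 𝔸ˣ) j z μ : 𝔸)‖ ≤ cP / 2 := by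
    intro j _ z μ _
    rw [hmul, sub_self, norm_zero]; exact hα.le
  have h66 : ∀ b ∈ {b : Site d × Fin d | SideTouches (Ω 0) b.1 b.2},
      ‖(((1 : Site d → Fin d → 𝔸ˣ) b.1 b.2 : 𝔸ˣ) : 𝔸) - 1‖ ≤ cP / 2 := by
    intro b _
    rw [Pi.one_apply, Pi.one_apply, Units.val_one, sub_self, norm_zero]; exact hα.le
  have body := H (cP / 2) (cP / 2) hα hα (by linarith) 1 1 h1u h1u hA hA' hAx h135 h66 m hm hmk
  -- the exponent constant is positive
  have hcst : 0 < 2 * (L * (5 * (d : ℝ) * L * B₀ * (cP / 2 + cP / 2))) + 8 * (8 * B₀' * (5 * (d : ℝ) * L * B₀) * (cP / 2 + cP / 2)) := by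
    have hL0 : (0 : ℝ) < L := by exact_mod_cast hL
    have hd0 : (0 : ℝ) < d := by exact_mod_cast (lt_of_lt_of_le (by norm_num) hd2)
    have h1 : 0 < 2 * (L * (5 * (d : ℝ) * L * B₀ * (cP / 2 + cP / 2))) := by positivity
    have h2 : 0 ≤ 8 * (8 * B₀' * (5 * (d : ℝ) * L * B₀) * (cP / 2 + cP / 2)) := by positivity
    linarith
  exact h59_body_false_of_emptyTruncation hd2 hL hη m Ω hΩ0 (Λs m) (Λb m) hΛs hΛb B₀ hcst body

end Sock

/-! ## §3 A univ member with empty lower-truncation data (the index `ZdIdx` admits it for `k ≥ 2`) -/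

/-- **A member of `ZdIdx d L` with `Ω_j = ℤᵈ` for every `j`, `k ≥ 2` levels, spacing `η > 0`, PROPER top data (`Λs k j = {j = k}`,
`Λb k j = {j = k}` — print's «Ω_j = T_η», 𝔅_k = the top lattice, exactly as in `B8LeafModelZd3NonVacuity.exists_member_univ`) and EMPTY data at
the truncation `m = 1` (`Λs 1 ≡ ∅`, `Λb 1 ≡ ∅`)**: the constraint data of the truncations `m < k` enter the laws of `ZdIdx` only through the
upper-bound clauses `hbox`∕`hclass` (vacuous on `∅`); `htower`∕`hpart` read `Λs k` (the PARTITION clause by the floor map, as in the cited file).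
Realised by `Λs m j := {j = m ∧ m = k}`, `Λb m j := {j = m ∧ m = k}`. [cite: Balaban1985RegularSpaces, (1.3)–(1.6) p.77, (1.28)–(1.29) p.81, p.77 («Ω_j = T_η»)] -/
theorem exists_member_univ_emptyTruncation {L : ℕ} (hL : 1 ≤ L) {k : ℕ} (hk : 2 ≤ k) {η : ℝ} (hη : 0 < η) :
    ∃ i : ZdIdx d L, i.Ω 0 = Set.univ ∧ i.k = k ∧ i.η = η ∧ (∀ j, i.Ω j = Set.univ) ∧
      (∀ j, i.Λs k j = {_y | j = k}) ∧ (∀ j, i.Λb k j = {_c | j = k}) ∧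
      (∀ j, i.Λs 1 j = ∅) ∧ (∀ j, i.Λb 1 j = ∅) := by
  classical
  have hk1 : 1 ≤ k := le_trans (by norm_num) hk
  refine ⟨⟨η, hη, k, hk1, fun _ => Set.univ, fun _ => le_rfl, fun m j => {_y | j = m ∧ m = k}, fun m j => {_c | j = m ∧ m = k},
      fun _ _ _ _ _ _ _ _ => Set.mem_univ _, ?_, fun _ _ _ _ _ _ => Set.mem_univ _, ?_⟩,
    rfl, rfl, rfl, fun _ => rfl, ?_, ?_, ?_, ?_⟩
  · intro m _ j _ c hc
    exact Or.inl ⟨hc, hc⟩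
  · intro x _
    refine ⟨k, le_rfl, flm L k x, ⟨rfl, rfl⟩, ?_⟩
    obtain ⟨h1, h2⟩ := (under_iff_tower L k (flm L k x) x).1 (under_flm hL k x)
    exact fun i => ⟨h1 i, h2 i⟩
  · intro j
    ext y
    simp
  · intro j
    ext c
    simp
  · intro j
    exact Set.eq_empty_of_forall_notMem fun y hy => absurd hy.2 (by omega)
  · intro j
    exact Set.eq_empty_of_forall_notMem fun c hc => absurd hc.2 (by omega)

/-! ## §4 ★★ «`SockH59` at every univ member» is unsatisfiable -/

section Forall

variable {𝔸 : Type*} [CStarAlgebra 𝔸] [Nontrivial 𝔸]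

/-- ★★ **THE HYPOTHESIS «`SockH59` AT EVERY UNIV MEMBER» IS UNSATISFIABLE** (`d ≥ 2`, `L ≥ 1`, every `B₀ > 0`, `B₀′ ≥ 0`, `cP > 0`, every
nontrivial C⋆-algebra `𝔸`): `¬ ∀ i : {i : ZdIdx d L // i.Ω 0 = univ}, SockH59 L B₀ B₀′ cP i.η i.k i.Ω i.Λs i.Λb` — the member of
`exists_member_univ_emptyTruncation` (`k = 2`, `η = 1`) and `not_sockH59_of_emptyTruncation` at its truncation `m = 1`.  CONSEQUENCE: every
theorem with this hypothesis (the univ-keyed repair shape of the N05 → N16 edge, e.g. `Summit.….N16OfSocketsZd3.n16_of_socketsZd3E`; any use of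
`B8LeafKnitZd3E.thm4Printed_zd3_mapE` at `ι := Subtype.val` over the univ sub-index) is VACUOUS as stated; a sound sub-index must also pin the
truncation data (e.g. the all-torus proper members of `B8LeafModelZd3NonVacuity.exists_member_univ`).  Nothing printed is refuted.
[cite: Balaban1985RegularSpaces, (1.59) p.86, Thm 4 p.88, p.77 («Ω_j = T_η», 𝔅_m of the truncated sequences); Balaban1985BackgroundPropagators, Thm 3.3 p.399] -/
theorem not_forall_univ_sockH59 (hd2 : 2 ≤ d) {L : ℕ} (hL : 1 ≤ L) {B₀ B₀' cP : ℝ} (hB₀ : 0 < B₀) (hB₀' : 0 ≤ B₀')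
    (hcP : 0 < cP) :
    ¬ ∀ i : {i : ZdIdx d L // i.Ω 0 = Set.univ}, SockH59 (𝔸 := 𝔸) L B₀ B₀' cP i.1.η i.1.k i.1.Ω i.1.Λs i.1.Λb := by
  intro H
  obtain ⟨i, hΩ0, hik, -, -, -, -, hΛs1, hΛb1⟩ :=
    exists_member_univ_emptyTruncation (d := d) hL (k := 2) le_rfl one_pos
  exact not_sockH59_of_emptyTruncation hd2 hL i.hη (m := 1) le_rfl (by rw [hik]; norm_num) i.Ω hΩ0 i.Λs i.Λb
    (fun j _ => hΛs1 j) (fun j _ => hΛb1 j) hB₀ hB₀' hcP (H ⟨i, hΩ0⟩)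

/-- **… AND OVER THE WHOLE INDEX** (the binder shape `∀ i : ZdIdx d L, SockH59 … i` of `B8LeafModelZd.thm4Printed_zd` ∕ `B8LeafModelZd3.thm4Printed_zd3`;
already vacuous at the cube members for `L ≤ ρ` by `B8SockH59NotAtCube.not_sockH59_cubeMember` — here for every `L ≥ 1`).
[cite: Balaban1985RegularSpaces, (1.59) p.86, Thm 4 p.88; Balaban1985BackgroundPropagators, Thm 3.3 p.399] -/
theorem not_forall_sockH59 (hd2 : 2 ≤ d) {L : ℕ} (hL : 1 ≤ L) {B₀ B₀' cP : ℝ} (hB₀ : 0 < B₀) (hB₀' : 0 ≤ B₀') (hcP : 0 < cP) :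
    ¬ ∀ i : ZdIdx d L, SockH59 (𝔸 := 𝔸) L B₀ B₀' cP i.η i.k i.Ω i.Λs i.Λb :=
  fun H => not_forall_univ_sockH59 hd2 hL hB₀ hB₀' hcP fun i => H i.1

end Forall

#print axioms not_forall_univ_sockH59


end Literature.MathematicalPhysics.QuantumFieldTheory.Balaban1983to89.B8SockH59NotAtUnivDegenerate

end
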